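/-
Copyright (c) 2026 the pub-hodgecm-mathlib formalisation cell (harness21).  Prover seat hodgecm-mathlib-LH3-p02 (g5): line LH3 (closer stub `stub_N9`), LETTER L3′ SURJ-OF-FORWARD,
organ (Σ-WALL) — FILTRATION ROAD (W-ROAD CENSUS v1 6129001bfae4ccc0, RULING #26), brick (W3-G) part 3a: the pure-analysis quotient lemma of the two-sided compact reading.
-/
import Mathlib.Analysis.Calculus.MeanValue
import Mathlib.Analysis.SpecialFunctions.Trigonometric.Bounds
import Mathlib.Analysis.Complex.Basic
import HarnessLib

/-!
# (W3-G), PART 3a: THE ODD-ISED QUOTIENT `[G(ψ) − G(−ψ)] ∕ (2 sin ψ)` AT A UNIFORM FIRST-ORDER LIMIT (pure analysis; Varadarajan 1989 §6.4 Thms 22–24, Shelstad 1979 Lemma 4.3)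

Topic `NumberTheory/Rogawski1990`; namespace `Literature.NumberTheory.Rogawski1990`.  THEOREMS ONLY (no `def`, no instance, no notation, no axiom, no named fact, no `sorry`).
Cell `pub/hodgecm-mathlib`, crux H413 (`stmt-HodgeConjecture-24833`), F0∕P3c line LH3 (closer stub `stub_N9`), LETTER L3′ SURJ-OF-FORWARD, organ (Σ-WALL), FILTRATION ROAD brick
**(W3-G)** part 3a — the calculus behind the (G3-w-cor) clause of `hGcp` (part 3b, `ArchRankOneWallGeneratorsTwoSided`): a family `G_z : ℝ → ℂ` differentiable on the punctured
`(−1, 1)` whose derivatives tend to `A z` as `ψ → 0`, `ψ ≠ 0`, UNIFORMLY in the parameter `z` (Harish-Chandra's first-order limit, centre-uniform), and whose odd-ised values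
`G_z(ψ) − G_z(−ψ)` tend to `0` as `ψ → 0⁺` for `z` near `z₀` (vanishing order-0 jump), has `[G_z(ψ) − G_z(−ψ)] ∕ (2 sin ψ) → A z₀` JOINTLY as `(z, ψ) → (z₀, 0)`, `ψ ≠ 0` — the mean
value inequality on `[s, ψ]` with `s → 0⁺`, `ψ ∕ sin ψ → 1`, evenness of the quotient in `ψ`.  Count-neutral.

WHAT IS PROVED: `norm_sub_apply_neg_sub_two_mul_le` (the key estimate `‖G(ψ) − G(−ψ) − 2ψA‖ ≤ 2ηψ`), `nhdsWithin_ne_zero_vecCons_neBot` (the punctured filter of the split chart at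
`x = 0` is non-trivial), `tendsto_div_sin_nhdsNE`, **`tendsto_sub_apply_neg_div_two_mul_sin`** (the abstract two-sided quotient lemma).
HONEST LABEL: HC_CM is proved only modulo the 7 printed citations (2 remaining: hLiu418 = `stmt-HodgeConjecture-24832`, h413 = `stmt-HodgeConjecture-24833`) until rung 0 closes;
pure analysis over Mathlib, pays nothing by itself.

## References
* [Varadarajan1989] V. S. Varadarajan, *An Introduction to Harmonic Analysis on Semisimple Lie Groups*, Cambridge Stud. Adv. Math. 16 (1989), §6.4 Thms 22–24.
* [Shelstad1979] D. Shelstad, *Characters and inner forms of a quasi-split group over ℝ*, Compositio Math. 39 (1979), Lemma 4.3 p. 25, §4 p. 22.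
-/

set_option autoImplicit false

noncomputable section

open Set Filter Topology

namespace Literature.NumberTheory.Rogawski1990


/-! ## §0 Pure analysis: the odd-ised quotient at a uniform first-order limit -/

section Analysis

/-- **KEY ESTIMATE** (mean value inequality on `[s, ψ]`, `s → 0⁺`): if `G` is differentiable on the punctured `(−1, 1)`, `‖G′(ξ) − A‖ ≤ η` for `0 < |ξ| < δ ≤ 1`, and the odd-ised
value `G(ψ) − G(−ψ) → 0` as `ψ → 0⁺`, then `‖G(ψ) − G(−ψ) − 2ψA‖ ≤ 2ηψ` for `0 < ψ < δ`. [cite: Varadarajan1989, §6.4 Thm 22] -/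
theorem norm_sub_apply_neg_sub_two_mul_le {G : ℝ → ℂ} {A : ℂ} {η δ : ℝ} (hδ1 : δ ≤ 1)
    (hdiff : ∀ ψ ∈ Ioo (-1 : ℝ) 1, ψ ≠ 0 → DifferentiableAt ℝ G ψ)
    (hder : ∀ ψ : ℝ, ψ ≠ 0 → |ψ| < δ → ‖deriv G ψ - A‖ ≤ η)
    (hzero : Tendsto (fun ψ => G ψ - G (-ψ)) (𝓝[>] 0) (𝓝 0)) {ψ : ℝ} (hψ : 0 < ψ) (hψδ : ψ < δ) :
    ‖(G ψ - G (-ψ)) - 2 * ψ * A‖ ≤ 2 * η * ψ := by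
  set N : ℝ → ℂ := fun ξ => G ξ - G (-ξ) - 2 * ξ * A with hN
  have hη : 0 ≤ η := (norm_nonneg _).trans (hder ψ hψ.ne' (by rwa [abs_of_pos hψ]))
  -- derivative of `N` on `(0, δ)`
  have hderiv : ∀ ξ : ℝ, 0 < ξ → ξ < δ → HasDerivAt N (deriv G ξ + deriv G (-ξ) - 2 * A) ξ := by
    intro ξ hξ hξδ
    have h1 : HasDerivAt G (deriv G ξ) ξ :=
      (hdiff ξ ⟨by linarith, by linarith⟩ hξ.ne').hasDerivAt
    have h2 : HasDerivAt G (deriv G (-ξ)) (-ξ) :=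
      (hdiff (-ξ) ⟨by linarith, by linarith⟩ (neg_ne_zero.2 hξ.ne')).hasDerivAt
    have h3 : HasDerivAt (fun ξ : ℝ => G (-ξ)) (-deriv G (-ξ)) ξ := by
      have := h2.scomp ξ (hasDerivAt_neg ξ)
      simpa [Function.comp_def, mul_comm] using this
    have h4 : HasDerivAt (fun ξ : ℝ => 2 * (ξ : ℂ) * A) (2 * 1 * A) ξ := by
      have := ((Complex.ofRealCLM.hasDerivAt (x := ξ)).const_mul (2 : ℂ)).mul_const A
      simpa using this
    refine ((h1.sub h3).sub h4).congr_deriv ?_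
    ring
  have hbound : ∀ ξ : ℝ, 0 < ξ → ξ < δ → ‖deriv G ξ + deriv G (-ξ) - 2 * A‖ ≤ 2 * η := by
    intro ξ hξ hξδ
    have e : deriv G ξ + deriv G (-ξ) - 2 * A = (deriv G ξ - A) + (deriv G (-ξ) - A) := by ring
    rw [e]
    refine (norm_add_le _ _).trans ?_
    have h1 := hder ξ hξ.ne' (by rwa [abs_of_pos hξ])
    have h2 := hder (-ξ) (neg_ne_zero.2 hξ.ne') (by rwa [abs_neg, abs_of_pos hξ])
    linarith
  -- mean value inequality on `[s, ψ]`, `0 < s ≤ ψ`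
  have hmvt : ∀ s : ℝ, 0 < s → s ≤ ψ → ‖N ψ - N s‖ ≤ 2 * η * ψ := by
    intro s hs hsψ
    have h := norm_image_sub_le_of_norm_deriv_le_segment' (f := N) (f' := fun ξ => deriv G ξ + deriv G (-ξ) - 2 * A) (a := s) (b := ψ)
      (fun ξ hξ => (hderiv ξ (hs.trans_le hξ.1) (hξ.2.trans_lt hψδ)).hasDerivWithinAt)
      (fun ξ hξ => hbound ξ (hs.trans_le hξ.1) (hξ.2.trans hψδ)) ψ ⟨hsψ, le_rfl⟩
    refine h.trans ?_
    nlinarith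
  -- `N s → 0` as `s → 0⁺`
  have hNs : Tendsto N (𝓝[>] 0) (𝓝 0) := by
    have h2 : Tendsto (fun s : ℝ => 2 * (s : ℂ) * A) (𝓝[>] 0) (𝓝 0) := by
      have : Tendsto (fun s : ℝ => 2 * (s : ℂ) * A) (𝓝 0) (𝓝 (2 * ((0 : ℝ) : ℂ) * A)) :=
        ((Complex.continuous_ofReal.tendsto 0).const_mul 2).mul_const A
      simp only [Complex.ofReal_zero, mul_zero, zero_mul] at this
      exact this.mono_left nhdsWithin_le_nhds
    have := hzero.sub h2
    simpa only [hN, sub_zero] using this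
  have hlim : Tendsto (fun s => ‖N ψ - N s‖) (𝓝[>] 0) (𝓝 ‖N ψ - 0‖) :=
    (tendsto_const_nhds.sub hNs).norm
  rw [sub_zero] at hlim
  have hev : ∀ᶠ s in 𝓝[>] (0 : ℝ), ‖N ψ - N s‖ ≤ 2 * η * ψ := by
    filter_upwards [Ioo_mem_nhdsGT hψ] with s hs
    exact hmvt s hs.1 hs.2.le
  exact le_of_tendsto hlim hev

/-- `![0, θ₁, θ₀]` lies in the closure of `{v | v 0 ≠ 0}`: the punctured filter of ★ (A0-DOCKED-JOINT) is non-trivial (limits along it are unique). [cite: Shelstad1979, §4 p. 22] -/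
theorem nhdsWithin_ne_zero_vecCons_neBot (θ₁ θ₀ : ℝ) : (𝓝[{v : Fin 3 → ℝ | v 0 ≠ 0}] (![0, θ₁, θ₀] : Fin 3 → ℝ)).NeBot := by
  refine mem_closure_iff_nhdsWithin_neBot.1 ?_
  have hu : Tendsto (fun s : ℝ => (![s, θ₁, θ₀] : Fin 3 → ℝ)) (𝓝[≠] 0) (𝓝 ![0, θ₁, θ₀]) := by
    refine (tendsto_pi_nhds.2 fun i => ?_).mono_left nhdsWithin_le_nhds
    fin_cases i
    · exact tendsto_id
    · exact tendsto_const_nhds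
    · exact tendsto_const_nhds
  exact mem_closure_of_tendsto hu (eventually_nhdsWithin_of_forall fun s hs => hs)

/-- `ψ ∕ sin ψ → 1` at `0` (`sin′ 0 = 1`). [cite: Varadarajan1989, §6.4] -/
theorem tendsto_div_sin_nhdsNE : Tendsto (fun ψ : ℝ => ψ / Real.sin ψ) (𝓝[≠] 0) (𝓝 1) := by
  have h := (Real.hasDerivAt_sin 0).tendsto_slope_zero
  simp only [zero_add, Real.sin_zero, sub_zero, Real.cos_zero, smul_eq_mul] at h
  have h' : Tendsto (fun t : ℝ => (t⁻¹ * Real.sin t)⁻¹) (𝓝[≠] 0) (𝓝 (1 : ℝ)⁻¹) := h.inv₀ one_ne_zero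
  rw [inv_one] at h'
  refine h'.congr' (Eventually.of_forall fun t => ?_)
  simp only [mul_inv, inv_inv, div_eq_mul_inv]

/-- **ABSTRACT TWO-SIDED QUOTIENT LEMMA.**  A family `G z : ℝ → ℂ` differentiable on the punctured `(−1, 1)`, with `∂G_z(ψ) → A z` as `ψ → 0`, `ψ ≠ 0`, UNIFORMLY in `z`, whose odd-ised
values `G_z(ψ) − G_z(−ψ) → 0` (`ψ → 0⁺`) for `z` near `z₀`, and `A` continuous at `z₀`: then `[G_z(ψ) − G_z(−ψ)] ∕ (2 sin ψ) → A z₀` as `(z, ψ) → (z₀, 0)`, `ψ ≠ 0`, JOINTLY.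
[cite: Varadarajan1989, §6.4 Thms 22–24] [cite: Shelstad1979, Lemma 4.3 p. 25] -/
theorem tendsto_sub_apply_neg_div_two_mul_sin {ι : Type*} [TopologicalSpace ι] {G : ι → ℝ → ℂ} {A : ι → ℂ} {z₀ : ι}
    (hdiff : ∀ z, ∀ ψ ∈ Ioo (-1 : ℝ) 1, ψ ≠ 0 → DifferentiableAt ℝ (G z) ψ)
    (hunif : ∀ ε : ℝ, 0 < ε → ∀ᶠ ψ in 𝓝[≠] (0 : ℝ), ∀ z, ‖deriv (G z) ψ - A z‖ ≤ ε)
    (hzero : ∀ᶠ z in 𝓝 z₀, Tendsto (fun ψ => G z ψ - G z (-ψ)) (𝓝[>] 0) (𝓝 0))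
    (hA : ContinuousAt A z₀) :
    Tendsto (fun p : ι × ℝ => (G p.1 p.2 - G p.1 (-p.2)) / (2 * Real.sin p.2)) (𝓝 z₀ ×ˢ 𝓝[≠] (0 : ℝ)) (𝓝 (A z₀)) := by
  have hsin : ∀ᶠ p : ι × ℝ in 𝓝 z₀ ×ˢ 𝓝[≠] (0 : ℝ), Real.sin p.2 ≠ 0 := by
    have h1 : ∀ᶠ ψ in 𝓝[≠] (0 : ℝ), Real.sin ψ ≠ 0 := by
      have hI : ∀ᶠ ψ in 𝓝[≠] (0 : ℝ), ψ ∈ Ioo (-Real.pi) Real.pi :=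
        mem_nhdsWithin_of_mem_nhds (Ioo_mem_nhds (neg_lt_zero.2 Real.pi_pos) Real.pi_pos)
      filter_upwards [hI, self_mem_nhdsWithin] with ψ hψ (hψ0 : ψ ≠ 0)
      intro hs
      rcases lt_or_gt_of_ne hψ0 with hlt | hgt
      · exact (Real.sin_neg_of_neg_of_neg_pi_lt hlt hψ.1).ne hs
      · exact (Real.sin_pos_of_pos_of_lt_pi hgt hψ.2).ne' hs
    exact tendsto_snd.eventually h1
  have hdecomp : ∀ᶠ p : ι × ℝ in 𝓝 z₀ ×ˢ 𝓝[≠] (0 : ℝ), (G p.1 p.2 - G p.1 (-p.2)) / (2 * Real.sin p.2) =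
      ((G p.1 p.2 - G p.1 (-p.2)) - 2 * p.2 * A p.1) / (2 * Real.sin p.2) + A p.1 * ((p.2 / Real.sin p.2 : ℝ) : ℂ) := by
    filter_upwards [hsin] with p hp
    have hp' : (2 * (Real.sin p.2 : ℂ)) ≠ 0 := mul_ne_zero two_ne_zero (Complex.ofReal_ne_zero.2 hp)
    push_cast
    field_simp
    ring
  have hlimA : Tendsto (fun p : ι × ℝ => A p.1) (𝓝 z₀ ×ˢ 𝓝[≠] (0 : ℝ)) (𝓝 (A z₀)) :=
    hA.tendsto.comp tendsto_fst
  have hlim2 : Tendsto (fun p : ι × ℝ => A p.1 * ((p.2 / Real.sin p.2 : ℝ) : ℂ)) (𝓝 z₀ ×ˢ 𝓝[≠] (0 : ℝ)) (𝓝 (A z₀ * ((1 : ℝ) : ℂ))) :=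
    hlimA.mul ((Complex.continuous_ofReal.tendsto 1).comp (tendsto_div_sin_nhdsNE.comp tendsto_snd))
  rw [Complex.ofReal_one, mul_one] at hlim2
  have hlim1 : Tendsto (fun p : ι × ℝ => ((G p.1 p.2 - G p.1 (-p.2)) - 2 * p.2 * A p.1) / (2 * Real.sin p.2)) (𝓝 z₀ ×ˢ 𝓝[≠] (0 : ℝ)) (𝓝 0) := by
    rw [Metric.tendsto_nhds]
    intro ε hε
    obtain ⟨U, hU, hUε⟩ := (hunif (ε / 4) (by positivity)).exists_mem
    obtain ⟨δ₁, hδ₁, hδ₁U⟩ := Metric.mem_nhdsWithin_iff.1 hU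
    set δ := min δ₁ 1 with hδ
    have hδpos : 0 < δ := lt_min hδ₁ one_pos
    have hder : ∀ z, ∀ ψ : ℝ, ψ ≠ 0 → |ψ| < δ → ‖deriv (G z) ψ - A z‖ ≤ ε / 4 := fun z ψ hψ0 hψδ =>
      hUε ψ (hδ₁U ⟨by simpa [Real.dist_eq] using hψδ.trans_le (min_le_left _ _), hψ0⟩) z
    have hψev : ∀ᶠ ψ in 𝓝[≠] (0 : ℝ), ψ ≠ 0 ∧ |ψ| < δ := by
      filter_upwards [self_mem_nhdsWithin, mem_nhdsWithin_of_mem_nhds (Metric.ball_mem_nhds (0 : ℝ) hδpos)] with ψ hψ hψ'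
      exact ⟨hψ, by simpa [Real.dist_eq] using hψ'⟩
    filter_upwards [hzero.prod_mk hψev] with p hp
    obtain ⟨hz, hψ0, hψδ⟩ := hp
    rw [dist_zero_right]
    -- reduce to `ψ > 0` by evenness of the quotient
    have key : ∀ ψ : ℝ, 0 < ψ → ψ < δ → ‖((G p.1 ψ - G p.1 (-ψ)) - 2 * ψ * A p.1) / (2 * Real.sin ψ)‖ < ε := by
      intro ψ hψ hψδ'
      have hψ1 : ψ ≤ 1 := (hψδ'.le.trans (min_le_right _ _))
      have hest := norm_sub_apply_neg_sub_two_mul_le (min_le_right δ₁ 1) (hdiff p.1) (hder p.1) hz hψ hψδ'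
      have hsinpos : ψ / 2 < Real.sin ψ := by
        have := Real.sin_gt_sub_cube hψ
        nlinarith [pow_le_of_le_one hψ.le hψ1 (by norm_num : (3 : ℕ) ≠ 0)]
      have hsin0 : 0 < Real.sin ψ := by linarith
      rw [norm_div, Complex.norm_mul, Complex.norm_real, Complex.norm_two, Real.norm_eq_abs, abs_of_pos hsin0]
      rw [div_lt_iff₀ (by positivity)]
      nlinarith
    rcases lt_or_gt_of_ne hψ0 with hlt | hgt
    · have h := key (-p.2) (neg_pos.2 hlt) (by rwa [abs_of_neg hlt] at hψδ)
      have e : ((G p.1 (-p.2) - G p.1 (- -p.2)) - 2 * ((-p.2 : ℝ) : ℂ) * A p.1) / (2 * Real.sin (-p.2)) =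
          ((G p.1 p.2 - G p.1 (-p.2)) - 2 * p.2 * A p.1) / (2 * Real.sin p.2) := by
        rw [neg_neg, Real.sin_neg]; push_cast
        rw [← neg_div_neg_eq]; ring_nf
      rwa [e] at h
    · exact key p.2 hgt (by rwa [abs_of_pos hgt] at hψδ)
  have := (hlim1.add hlim2).congr' (hdecomp.mono fun p hp => hp.symm)
  rwa [zero_add] at this

end Analysis

end Literature.NumberTheory.Rogawski1990

end
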